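import Summits.BirchSwinnertonDyer.BirchSwinnertonDyer.Theses.BiquadraticEisensteinDescent
import Literature.NumberTheory.QuadraticFields.SmallClassNumberSplitPrimes
import Literature.NumberTheory.EllipticCurves.HeegnerPointsImaginaryQuadraticProofs
import Literature.NumberTheory.EllipticCurves.ModularityVersionApProofs
import HarnessLib

set_option linter.dupNamespace false -- `Summit.BirchSwinnertonDyer.BirchSwinnertonDyer.Theorems.…` (summit = sub)
set_option autoImplicit false

/-!
# Crux `HeegnerTwistCouplingInSupply` (stmt-BirchSwinnertonDyer-21381), line `size-tail`: at `p = 5` and `6 ∣ N_W` the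
# coupling-free regime `h(K′) < p` is EMPTY — kernel certificate (modulo Watkins 2004) of the HBULK census's tail law

Route `BiquadraticEisensteinDescent` (cell `pub/bsd-wall`, row 12; width seat `bsd-wall-cm-bed-w4` g5 in support of the
row-12 KEY lead `bsd-line-ibd-p1`). Companion of `…HeegnerTwistCouplingInSupplyHTail.lean` (p606543: the h-threshold frame,
`heegnerTwistCouplingInSupply_of_hTail`, `hTail_iff`) and of the instrument HBULK-CENSUS-w4g5.md (kit j299534: 16 of the 72
CORE census pairs — those with `p = 5`, `6 ∣ N_W` — have NO Heegner field with `h(K′) < 5`).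

THEOREMS ONLY, all modulo the tree's named fact `watkins2004_table4` (Watkins, Math. Comp. 73 (2004), Table 4: the class
number `≤ 100` lists are complete), through the Literature theorem
`SmallClassNumberSplit.five_le_classNumber_of_split_two_three_five` (an imaginary quadratic field with `2, 3, 5` split has
`h ≥ 5`: Watkins rows 1–4 + decomposition laws + a kernel table of 25 form class numbers):

* `five_le_classNumber_of_heegner_of_thirty_dvd` — a Heegner field `K′` for a level `N` with `30 ∣ N` has `5 ≤ h(K′)`;
* `five_le_classNumber_of_heegner_at_five` — the same for `N = N_W` with `6 ∣ N_W` and `W` bad at `5` (`5 ∣ N_W` by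
  `dvd_conductorNorm_iff_not_hasGoodReductionAtPrime`), i.e. on the crux's corner with `6 ∣ N_W` at `p = 5`;
* `hTail_hypothesis_at_five_of_six_dvd` — hence the extra hypothesis of the h-TAIL statement («every Heegner `K′` of
  `N_W` with `4 < |d|`, `h(K′) < 5` has vanishing twist») holds VACUOUSLY for such `W`: on the sub-family
  `{(W, 5) : 6 ∣ N_W}` (16 of the 30 census pairs at `p = 5`: `N = 900, 2700, 3600, 10800, 14400`) the BULK/TAIL frame
  certifiably contributes nothing and the crux IS the coupling proper.

Supports stmt-BirchSwinnertonDyer-21381; closes nothing; conditional on `watkins2004_table4` only. BSD is not proved by any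
of this; the coupling is open.

APPENDIX (`p = 7`, same seat): by `SmallClassNumberSplit.seven_le_classNumber_or_discr_eq_neg47` (Table 4 rows 1–6 + a
kernel table over `|D| ≤ 3763`), a Heegner field of a level `N` with `42 ∣ N` has `h ≥ 7` OR is `ℚ(√−47)` (`h = 5`); so at
`p = 7` with `6 ∣ N_W` the h-tail side condition collapses to ONE twist: `L(W^{(−47)}, 1) = 0` (if `ℚ(√−47)` is Heegner for
`N_W` at all) — `hTail_hypothesis_at_seven_of_six_dvd`. Census instance: 14112x1@7 (`N = 2⁵3²7²`), whose twist by `−47`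
has analytic rank 2 (HBULK), is in the tail for exactly this reason; 14112bj1/bk1/bn1 (rank 0 at `−47`) are in the bulk.
-/

noncomputable section

open scoped NumberField

open WeierstrassCurve NumberField
  Literature.NumberTheory.EllipticCurves Literature.NumberTheory.EllipticCurves.Rank1Residual
  Literature.NumberTheory.QuadraticFields

namespace Summit.BirchSwinnertonDyer.BirchSwinnertonDyer.Theorems.BiquadraticEisensteinDescentHeegnerTwistCouplingInSupplyHTailFive

/-- **A Heegner field for a level divisible by `30` has class number `≥ 5`** (modulo Watkins' Table 4): if `K` is
imaginary quadratic, every prime of `N` splits in `K`, and `30 ∣ N`, then `2, 3, 5` split in `K`, so `5 ≤ h(K)` by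
`SmallClassNumberSplit.five_le_classNumber_of_split_two_three_five`. [cite: Watkins2004ClassNumbers, Table 4 p. 936] -/
theorem five_le_classNumber_of_heegner_of_thirty_dvd (hW : watkins2004_table4) {N : ℕ} (h30 : 30 ∣ N)
    {K : Type} [Field K] [NumberField K] (hK : IsImaginaryQuadratic K) (hH : SatisfiesHeegnerHypothesis N K) :
    5 ≤ NumberField.classNumber K := by
  have h2 : ((Ideal.span {(2 : ℤ)}).primesOver (𝓞 K)).ncard = 2 := by
    simpa using hH 2 Nat.prime_two (dvd_trans (by norm_num) h30)
  have h3 := hH 3 Nat.prime_three (dvd_trans (by norm_num) h30)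
  have h5 := hH 5 Nat.prime_five (dvd_trans (by norm_num) h30)
  exact SmallClassNumberSplit.five_le_classNumber_of_split_two_three_five hW hK.1 hK.discr_neg h2 h3 h5

/-- **On the crux's corner at `p = 5` with `6 ∣ N_W`, every Heegner field has `h(K′) ≥ 5`** (modulo Watkins' Table 4):
`W` bad at `5` gives `5 ∣ N_W` (`dvd_conductorNorm_iff_not_hasGoodReductionAtPrime`), so `30 ∣ N_W`.
[cite: Watkins2004ClassNumbers, Table 4 p. 936] -/
theorem five_le_classNumber_of_heegner_at_five (hW : watkins2004_table4)
    (W : WeierstrassCurve ℚ) [W.IsElliptic] [Fact (Nat.Prime 5)] (h6 : 6 ∣ W.conductorNorm ℤ) (hbad : ¬ Good W 5)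
    {K : Type} [Field K] [NumberField K] (hK : IsImaginaryQuadratic K)
    (hH : SatisfiesHeegnerHypothesis (W.conductorNorm ℤ) K) :
    5 ≤ NumberField.classNumber K := by
  have h5 : 5 ∣ W.conductorNorm ℤ := (W.dvd_conductorNorm_iff_not_hasGoodReductionAtPrime 5).mpr hbad
  have h30 : 30 ∣ W.conductorNorm ℤ := by
    have : Nat.Coprime 6 5 := by norm_num
    simpa using this.mul_dvd_of_dvd_of_dvd h6 h5
  exact five_le_classNumber_of_heegner_of_thirty_dvd hW h30 hK hH

/-- **The h-TAIL hypothesis is VACUOUS at `p = 5` when `6 ∣ N_W`** (modulo Watkins' Table 4): for `W` bad at `5` with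
`6 ∣ N_W`, the side condition of the h-threshold frame — «every Heegner field `K′` of `N_W` with `4 < |d_K′|` and
`h(K′) < 5` has `L(W^{(d_K′)},1) = 0`» — holds for the empty reason that no Heegner `K′` has `h(K′) < 5`. So on this
sub-family the frame of line `size-tail` (any threshold: `hTail_iff`, p606543) isolates nothing: the crux there is the
coupling itself (HBULK census: 16/72 CORE pairs). [cite: Watkins2004ClassNumbers, Table 4 p. 936] -/
theorem hTail_hypothesis_at_five_of_six_dvd (hW : watkins2004_table4)
    (W : WeierstrassCurve ℚ) [W.IsElliptic] [Fact (Nat.Prime 5)] (h6 : 6 ∣ W.conductorNorm ℤ) (hbad : ¬ Good W 5) :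
    ∀ (K : Type) [Field K] [NumberField K], IsImaginaryQuadratic K → 4 < (NumberField.discr K).natAbs →
      SatisfiesHeegnerHypothesis (W.conductorNorm ℤ) K → NumberField.classNumber K < 5 →
      (W.quadraticTwist (NumberField.discr K : ℚ)).entireLFunction 1 = 0 := by
  intro K _ _ hK _ hH hlt
  exact absurd (five_le_classNumber_of_heegner_at_five hW W h6 hbad hK hH) (not_le.mpr hlt)


/-! ### Appendix: `p = 7` — the bulk at `6 ∣ N_W` is at most the single field `ℚ(√−47)` -/

/-- **At `p = 7` with `6 ∣ N_W`, a Heegner field has `h(K′) ≥ 7` or is `ℚ(√−47)`** (modulo Watkins' Table 4): `W` bad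
at `7` gives `7 ∣ N_W`, so `2, 3, 7` split in every Heegner `K′`, and
`SmallClassNumberSplit.seven_le_classNumber_or_discr_eq_neg47` applies. [cite: Watkins2004ClassNumbers, Table 4 p. 936] -/
theorem seven_le_classNumber_or_discr_eq_neg47_of_heegner_at_seven (hW : watkins2004_table4)
    (W : WeierstrassCurve ℚ) [W.IsElliptic] [Fact (Nat.Prime 7)] (h6 : 6 ∣ W.conductorNorm ℤ) (hbad : ¬ Good W 7)
    {K : Type} [Field K] [NumberField K] (hK : IsImaginaryQuadratic K)
    (hH : SatisfiesHeegnerHypothesis (W.conductorNorm ℤ) K) :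
    7 ≤ NumberField.classNumber K ∨ NumberField.discr K = -47 := by
  have h7 : 7 ∣ W.conductorNorm ℤ := (W.dvd_conductorNorm_iff_not_hasGoodReductionAtPrime 7).mpr hbad
  have h2 : ((Ideal.span {(2 : ℤ)}).primesOver (𝓞 K)).ncard = 2 := by
    simpa using hH 2 Nat.prime_two (dvd_trans (by norm_num) h6)
  have h3 := hH 3 Nat.prime_three (dvd_trans (by norm_num) h6)
  have h7s := hH 7 (by norm_num) h7
  exact SmallClassNumberSplit.seven_le_classNumber_or_discr_eq_neg47 hW hK.1 hK.discr_neg h2 h3 h7s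

/-- **The h-TAIL side condition at `p = 7`, `6 ∣ N_W`, collapses to ONE twist** (modulo Watkins' Table 4): if
`L(W^{(−47)}, 1) = 0` (the junk-or-genuine value `(W.quadraticTwist (−47)).entireLFunction 1`), then every Heegner `K′`
of `N_W` with `4 < |d_K′|` and `h(K′) < 7` has vanishing twist — because such a `K′` is `ℚ(√−47)`. (If `ℚ(√−47)` is not
Heegner for `N_W`, the side condition is vacuous outright.) [cite: Watkins2004ClassNumbers, Table 4 p. 936] -/
theorem hTail_hypothesis_at_seven_of_six_dvd (hW : watkins2004_table4)
    (W : WeierstrassCurve ℚ) [W.IsElliptic] [Fact (Nat.Prime 7)] (h6 : 6 ∣ W.conductorNorm ℤ) (hbad : ¬ Good W 7)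
    (h47 : (W.quadraticTwist ((-47 : ℤ) : ℚ)).entireLFunction 1 = 0) :
    ∀ (K : Type) [Field K] [NumberField K], IsImaginaryQuadratic K → 4 < (NumberField.discr K).natAbs →
      SatisfiesHeegnerHypothesis (W.conductorNorm ℤ) K → NumberField.classNumber K < 7 →
      (W.quadraticTwist (NumberField.discr K : ℚ)).entireLFunction 1 = 0 := by
  intro K _ _ hK _ hH hlt
  rcases seven_le_classNumber_or_discr_eq_neg47_of_heegner_at_seven hW W h6 hbad hK hH with h | h
  · exact absurd h (not_le.mpr hlt)
  · rw [h]
    exact h47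

/-- … and conversely the side condition is VACUOUS when `ℚ(√−47)` is not a Heegner field of `N_W` (e.g. some prime
`q ∣ N_W` is inert or ramified in `ℚ(√−47)`). [cite: Watkins2004ClassNumbers, Table 4 p. 936] -/
theorem hTail_hypothesis_at_seven_of_six_dvd_of_not_heegner47 (hW : watkins2004_table4)
    (W : WeierstrassCurve ℚ) [W.IsElliptic] [Fact (Nat.Prime 7)] (h6 : 6 ∣ W.conductorNorm ℤ) (hbad : ¬ Good W 7)
    (h47 : ∀ (K : Type) [Field K] [NumberField K], IsImaginaryQuadratic K → NumberField.discr K = -47 →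
      ¬ SatisfiesHeegnerHypothesis (W.conductorNorm ℤ) K) :
    ∀ (K : Type) [Field K] [NumberField K], IsImaginaryQuadratic K → 4 < (NumberField.discr K).natAbs →
      SatisfiesHeegnerHypothesis (W.conductorNorm ℤ) K → NumberField.classNumber K < 7 →
      (W.quadraticTwist (NumberField.discr K : ℚ)).entireLFunction 1 = 0 := by
  intro K _ _ hK _ hH hlt
  rcases seven_le_classNumber_or_discr_eq_neg47_of_heegner_at_seven hW W h6 hbad hK hH with h | h
  · exact absurd h (not_le.mpr hlt)
  · exact absurd hH (h47 K hK h)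

end Summit.BirchSwinnertonDyer.BirchSwinnertonDyer.Theorems.BiquadraticEisensteinDescentHeegnerTwistCouplingInSupplyHTailFive

end
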